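import Summits.HubbardSuperconductivity.HubbardSuperconductivity.Theses.ColourTheSpin
import Literature.MathematicalPhysics.QuantumLattice.SpinGaugedHubbardTorus

/-!
# Route `ColourTheSpin`, support item `SgPairDictionary` (stmt-HubbardSuperconductivity-16275)

DICTIONARY I: at the trivial link configuration `k ≡ 1` the gauged `B₁g` pair field of the route
(the inlined `let P`, definitionally `spinGaugedPairField L`, `spinGaugedPairField_eq_inline`) has
matrix entries `(√2)⁻¹ · (pairField dWaveFormFactor L) s s'` — literally the landed Literature
theorem `spinGaugedPairField_apply_one_one` (Scalapino (1995) §2; the trivial configuration is the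
constant `(0, 0)`, `one_eq_const_zero`). [folklore]
-/

namespace Summit.HubbardSuperconductivity.ColourTheSpin

open Literature.MathematicalPhysics.QuantumLattice

/-- **Route item `SgPairDictionary`**: `Δ_d^g (s,1) (s',1) = (√2)⁻¹ · (pairField dWaveFormFactor L) s s'`
for every `L ≥ 1` and all occupation configurations `s, s'` (the landed
`spinGaugedPairField_apply_one_one`, transported along the definitional identities
`spinGaugedPairField_eq_inline` and `one_eq_const_zero`). Scalapino, Phys. Rep. 250 (1995) 329, §2.
[folklore] -/
theorem sgPairDictionary_proof :
    Summit.HubbardSuperconductivity.HubbardSuperconductivity.Theses.ColourTheSpin.SgPairDictionary := by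
  intro L _ s s'
  have h := spinGaugedPairField_apply_one_one L s s'
  rw [one_eq_const_zero, spinGaugedPairField_eq_inline] at h
  exact h

end Summit.HubbardSuperconductivity.ColourTheSpin
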